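import Summits.KontsevichZagierPeriods.KontsevichZagierPeriods.Theorems.BetaCancellation.Negative.LoadBearing

/-!
# `BetaCancellation` (stmt-KontsevichZagierPeriods-13633) — `[β(1/2,1/2)] ∼ [π]`, the representations and move 1

Companion of `Negative/KernelForm.lean`. The instance `a = b = 1/2` of the crux is cancellation
by `[β(1/2,1/2)] = [(0,1), t^{-1/2}(1-t)^{-1/2}]`, and `[β(1/2,1/2)] ∼ [π] = [{x²+y² ≤ 1}, 1]`
INSIDE the calculus by four moves formalised here: the affine substitution `t = (1+x)/2`
(rule 2), Kontsevich–Zagier's own §1.1 step `∫ dx/√(1−x²) = ∫ 2√(1−x²) dx` (one Newton–Leibniz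
move with primitive `−x√(1−x²)` from the point, plus integrand additivity), and
`∫ 2√(1−x²) dx = ∬_{disc} 1` (one Newton–Leibniz move along `y`). Consequences:
`equivalent_betaHalfRep_piRep`, `betaHalfRep_value : B(1/2,1/2) = π` (by soundness), and
`piCancellation_of_betaCancellation : BetaCancellation → KZ.PiCancellation` — the crux is at least
as strong as the OPEN `π`-cancellation crux of route AyoubSpecialisation
(stmt-KontsevichZagierPeriods-0540; motivic shadow open, Huber–Wüstholz 2022 App. A). Together with
`betaCancellation_of_summit`: `KZ.PiCancellation ≤ BetaCancellation ≤ KZKernelConjecture`.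
cdisprove (refuter) file; sorry-free, axioms ⊆ {propext, Classical.choice, Quot.sound}.
[Kontsevich–Zagier 2001, §1.1 (eq. (1) and the `√(1−x²)` example)]
-/

noncomputable section

set_option linter.dupNamespace false

namespace Summit.KontsevichZagierPeriods.KontsevichZagierPeriods.BetaCancellationNegative

open MeasureTheory Set
open Literature.NumberTheory.Transcendental
open Literature.NumberTheory.Transcendental.KZ
open Literature.ModelTheory.ExponentialFields (IsSemialgebraic isSemialgebraic_univ)
open MvPolynomial (aeval X C)
open Summit.KontsevichZagierPeriods.KontsevichZagierPeriods.Theses.TerasomaMultiplication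
  (BetaCancellation)
open Literature.NumberTheory.Transcendental.KZreg (unitIoo isSemialgebraic_unitIoo volume_unitIoo)

/-! ## `[β(1/2,1/2)] ∼ [π]`: the representations and move 1

The instance `a = b = 1/2` of the crux is cancellation by the class `[β(1/2,1/2)] =
[(0,1), (t(1-t))^{-1/2}]`, and `[β(1/2,1/2)] ∼ [π] = [{x²+y² ≤ 1}, 1]` by FOUR moves of the calculus
(§9.3–9.5: the affine substitution `t = (1+x)/2`, rule 2; Kontsevich–Zagier's own §1.1 step
`∫ dx/√(1-x²) = ∫ 2√(1-x²) dx`, one Newton–Leibniz move with primitive `−x√(1−x²)` plus integrand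
additivity; and `∫ 2√(1−x²) dx = ∬_{disc} 1`, one Newton–Leibniz move along `y`). Hence
`BetaCancellation` implies `KZ.PiCancellation` (`KZProduct.lean`; the open crux
stmt-KontsevichZagierPeriods-0540 of route AyoubSpecialisation, whose motivic shadow — injectivity
of effective into `2πi`-localised formal periods — is an open question, Huber–Wüstholz 2022 App. A). -/

/-! ### §1 The kernel at `a = b = 1/2` -/

/-- `t^{-1/2} (1-t)^{-1/2} = 1/√(t(1-t))` on `[0,1]`. [folklore] -/
theorem betaKernel_half_half {s : ℝ} (hs : 0 ≤ s) (hs' : s ≤ 1) :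
    betaKernel (1/2) (1/2) s = (√(s * (1 - s)))⁻¹ := by
  have he : ((1/2 : ℚ) : ℝ) - 1 = -(1/2 : ℝ) := by push_cast; ring
  simp only [betaKernel, he]
  rw [Real.rpow_neg hs, Real.rpow_neg (by linarith), ← Real.sqrt_eq_rpow, ← Real.sqrt_eq_rpow,
    ← mul_inv, ← Real.sqrt_mul hs]

/-- After `t = (1+x)/2`: `β-kernel((1+x)/2) · (1/2) = 1/√(1-x²)` on `[-1,1]`. [folklore] -/
theorem betaKernel_half_affine {t : ℝ} (ht : t ∈ Icc (-1:ℝ) 1) :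
    betaKernel (1/2) (1/2) ((1 + t) / 2) * (1/2) = (√(1 - t ^ 2))⁻¹ := by
  rw [betaKernel_half_half (by linarith [ht.1]) (by linarith [ht.2])]
  have h : (1 + t) / 2 * (1 - (1 + t) / 2) = (1 - t ^ 2) / 4 := by ring
  have h4 : √(4:ℝ) = 2 := by
    rw [show (4:ℝ) = 2 ^ 2 by norm_num, Real.sqrt_sq (by norm_num)]
  rw [h, Real.sqrt_div' _ (by norm_num : (0:ℝ) ≤ 4), h4, inv_div]
  ring

/-- Semialgebraicity of `1/√P` on `{P > 0}`: it is `√P · (1/P)` there. [folklore] -/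
theorem isSemialgebraicFunOn_of_eqOn_inv_sqrt {m : ℕ} {s : Set (Fin m → ℝ)}
    (hs : IsSemialgebraic ℚ s) (P : MvPolynomial (Fin m) ℚ) (hP : ∀ x ∈ s, 0 < aeval x P)
    {f : (Fin m → ℝ) → ℝ} (hf : ∀ x ∈ s, f x = (√(aeval x P))⁻¹) : IsSemialgebraicFunOn ℚ s f := by
  have h1 : IsSemialgebraicFunOn ℚ s (fun x => √(aeval x P)) :=
    IsSemialgebraicFunOn.sqrt_holds (isSemialgebraicFunOn_aeval hs P)
  have h2 : IsSemialgebraicFunOn ℚ s (fun x => aeval x (1 : MvPolynomial (Fin m) ℚ) / aeval x P) :=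
    isSemialgebraicFunOn_aeval_div_aeval hs 1 P fun x hx => (hP x hx).ne'
  refine (IsSemialgebraicFunOn.mul_holds h1 h2).congr fun x hx => ?_
  have hp := hP x hx
  have hsq : √(aeval x P) * √(aeval x P) = aeval x P := Real.mul_self_sqrt hp.le
  have hne : √(aeval x P) ≠ 0 := (Real.sqrt_pos.2 hp).ne'
  rw [hf x hx, Pi.mul_apply, map_one, one_div]
  calc √(aeval x P) * (aeval x P)⁻¹
      = √(aeval x P) * (√(aeval x P) * √(aeval x P))⁻¹ := by rw [hsq]
    _ = (√(aeval x P))⁻¹ := by rw [mul_inv, ← mul_assoc, mul_inv_cancel₀ hne, one_mul]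

/-- **`[β(1/2,1/2)] = [(0,1), t^{-1/2}(1-t)^{-1/2}]`**, the Beta representation of `π` in the
crux's pinned shape. [folklore] -/
def betaHalfRep : IntegralRep 1 where
  domain := unitIoo
  integrand := fun x => betaKernel (1/2) (1/2) (x 0)
  isSemialgebraic_domain := isSemialgebraic_unitIoo
  isSemialgebraicFunOn_integrand := by
    refine isSemialgebraicFunOn_of_eqOn_inv_sqrt isSemialgebraic_unitIoo (X 0 * (1 - X 0))
      (fun x hx => ?_) (fun x hx => ?_)
    · simp only [mem_unitIoo, mem_Ioo] at hx
      simp only [map_mul, map_sub, map_one, MvPolynomial.aeval_X]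
      exact mul_pos hx.1 (by linarith)
    · simp only [mem_unitIoo, mem_Ioo] at hx
      simp only [map_mul, map_sub, map_one, MvPolynomial.aeval_X]
      exact betaKernel_half_half hx.1.le hx.2.le
  integrableOn := integrableOn_comp_apply_zero_iff.2
    (integrableOn_betaKernel_and_integral_eq (a := 1/2) (b := 1/2) (by norm_num) (by norm_num)).1

/-- The domain of `betaHalfRep`. [folklore] -/
@[simp] theorem betaHalfRep_domain : betaHalfRep.domain = unitIoo := rfl

/-- The integrand of `betaHalfRep`. [folklore] -/
@[simp] theorem betaHalfRep_integrand :
    betaHalfRep.integrand = fun x => betaKernel (1/2) (1/2) (x 0) := rfl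

/-! ### §2 The intervals `(-1,1)`, `[-1,1] ⊆ ℝ¹` -/

/-- `(-1,1) ⊆ ℝ¹`. [folklore] -/
def symIoo : Set (Fin 1 → ℝ) := {x | x 0 ∈ Ioo (-1:ℝ) 1}

/-- `[-1,1] ⊆ ℝ¹`. [folklore] -/
def symIcc : Set (Fin 1 → ℝ) := {x | x 0 ∈ Icc (-1:ℝ) 1}

/-- Membership in `symIoo`. [folklore] -/
@[simp] theorem mem_symIoo (x : Fin 1 → ℝ) : x ∈ symIoo ↔ x 0 ∈ Ioo (-1:ℝ) 1 := Iff.rfl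

/-- Membership in `symIcc`. [folklore] -/
@[simp] theorem mem_symIcc (x : Fin 1 → ℝ) : x ∈ symIcc ↔ x 0 ∈ Icc (-1:ℝ) 1 := Iff.rfl

/-- `(-1,1)` is `ℚ`-semialgebraic. [folklore] -/
theorem isSemialgebraic_symIoo : IsSemialgebraic ℚ symIoo := by
  have h1 := Literature.ModelTheory.ExponentialFields.isSemialgebraic_setOf_eval_lt (k := ℚ) (R := ℝ)
    (-1 : MvPolynomial (Fin 1) ℚ) (X 0)
  have h2 := Literature.ModelTheory.ExponentialFields.isSemialgebraic_setOf_eval_lt (k := ℚ) (R := ℝ)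
    (X 0 : MvPolynomial (Fin 1) ℚ) 1
  have h := h1.inter h2
  simp only [map_neg, map_one, MvPolynomial.aeval_X] at h
  have hset : symIoo = {x : Fin 1 → ℝ | -1 < x 0} ∩ {x | x 0 < 1} := by
    ext x
    simp [symIoo]
  rw [hset]
  exact h

/-- `[-1,1]` is `ℚ`-semialgebraic. [folklore] -/
theorem isSemialgebraic_symIcc : IsSemialgebraic ℚ symIcc := by
  have h1 := Literature.ModelTheory.ExponentialFields.isSemialgebraic_setOf_eval_le (k := ℚ) (R := ℝ)
    (-1 : MvPolynomial (Fin 1) ℚ) (X 0)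
  have h2 := Literature.ModelTheory.ExponentialFields.isSemialgebraic_setOf_eval_le (k := ℚ) (R := ℝ)
    (X 0 : MvPolynomial (Fin 1) ℚ) 1
  have h := h1.inter h2
  simp only [map_neg, map_one, MvPolynomial.aeval_X] at h
  have hset : symIcc = {x : Fin 1 → ℝ | -1 ≤ x 0} ∩ {x | x 0 ≤ 1} := by
    ext x
    simp [symIcc]
  rw [hset]
  exact h

/-- `(-1,1) ⊆ [-1,1]`. [folklore] -/
theorem symIoo_subset_symIcc : symIoo ⊆ symIcc := fun _ hx => Ioo_subset_Icc_self hx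

/-- `[-1,1] ∖ (-1,1)` is null (two hyperplanes). [folklore] -/
theorem volume_symIcc_diff_symIoo : volume (symIcc \ symIoo) = 0 := by
  refine measure_mono_null (fun x hx => ?_)
    (measure_union_null (volume_setOf_apply_eq_zero (0 : Fin 1) (-1))
      (volume_setOf_apply_eq_zero (0 : Fin 1) 1))
  simp only [mem_sdiff, mem_symIcc, mem_Icc, mem_symIoo, mem_Ioo, not_and, not_lt] at hx
  simp only [mem_union, mem_setOf_eq]
  obtain ⟨⟨h1, h2⟩, h3⟩ := hx
  rcases h1.lt_or_eq with h1 | h1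
  · exact Or.inr (le_antisymm h2 (h3 h1))
  · exact Or.inl h1.symm

/-- `[-1,1] ⊆ ℝ¹` is the closed box. [folklore] -/
theorem symIcc_eq_pi : symIcc = Set.pi univ fun _ : Fin 1 => Icc (-1:ℝ) 1 := by
  ext x
  simp only [symIcc, mem_setOf_eq, mem_univ_pi, Fin.forall_fin_one]

/-- Continuous functions are integrable on `[-1,1] ⊆ ℝ¹`. [folklore] -/
theorem integrableOn_symIcc_of_continuous {f : (Fin 1 → ℝ) → ℝ} (hf : Continuous f) :
    IntegrableOn f symIcc := by
  rw [symIcc_eq_pi]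
  exact hf.continuousOn.integrableOn_compact (isCompact_univ_pi fun _ => isCompact_Icc)

/-- Continuous functions are integrable on `(-1,1) ⊆ ℝ¹`. [folklore] -/
theorem integrableOn_symIoo_of_continuous {f : (Fin 1 → ℝ) → ℝ} (hf : Continuous f) :
    IntegrableOn f symIoo :=
  (integrableOn_symIcc_of_continuous hf).mono_set symIoo_subset_symIcc

/-! ### §3 Move 1 (rule 2): the affine substitution `t = (1 + x)/2` -/

/-- The affine map `x ↦ (1 + x)/2` of `ℝ¹`. [folklore] -/
def halfAffine (x : Fin 1 → ℝ) : Fin 1 → ℝ := fun _ => (1 + x 0) / 2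

/-- Its derivative, `(1/2) · id`. [folklore] -/
def halfAffineDeriv : (Fin 1 → ℝ) →L[ℝ] (Fin 1 → ℝ) := (1/2 : ℝ) • ContinuousLinearMap.id ℝ _

/-- `halfAffine` is `(1/2) · id + 1/2`. [folklore] -/
theorem halfAffine_eq (x : Fin 1 → ℝ) : halfAffine x = halfAffineDeriv x + fun _ => (1/2 : ℝ) := by
  funext i
  obtain rfl : i = 0 := Fin.fin_one_eq_zero i
  simp [halfAffine, halfAffineDeriv]
  ring

/-- `halfAffine` has derivative `(1/2) · id`. [folklore] -/
theorem hasFDerivAt_halfAffine (x : Fin 1 → ℝ) : HasFDerivAt halfAffine halfAffineDeriv x := by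
  have : halfAffine = fun x => halfAffineDeriv x + fun _ => (1/2 : ℝ) := funext halfAffine_eq
  rw [this]
  exact halfAffineDeriv.hasFDerivAt.add_const _

/-- `|det ((1/2) · id_{ℝ¹})| = 1/2`. [folklore] -/
theorem abs_det_halfAffineDeriv : |halfAffineDeriv.det| = 1/2 := by
  have : halfAffineDeriv.det = 1/2 := by
    change LinearMap.det ((halfAffineDeriv : (Fin 1 → ℝ) →L[ℝ] (Fin 1 → ℝ)) :
      (Fin 1 → ℝ) →ₗ[ℝ] (Fin 1 → ℝ)) = 1/2
    rw [halfAffineDeriv, ContinuousLinearMap.toLinearMap_smul, ContinuousLinearMap.coe_id,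
      LinearMap.det_smul, LinearMap.det_id, Module.finrank_fin_fun]
    norm_num
  rw [this]
  norm_num

/-- `halfAffine` is injective. [folklore] -/
theorem injective_halfAffine : Function.Injective halfAffine := by
  intro x y h
  have h0 := congrFun h 0
  simp only [halfAffine] at h0
  funext i
  obtain rfl : i = 0 := Fin.fin_one_eq_zero i
  linarith

/-- `halfAffine` maps `(-1,1)` onto `(0,1)`. [folklore] -/
theorem image_halfAffine_symIoo : halfAffine '' symIoo = unitIoo := by
  ext y
  constructor
  · rintro ⟨x, hx, rfl⟩
    simp only [mem_symIoo, mem_Ioo] at hx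
    simp only [mem_unitIoo, halfAffine, mem_Ioo]
    constructor <;> linarith
  · intro hy
    simp only [mem_unitIoo, mem_Ioo] at hy
    refine ⟨fun _ => 2 * y 0 - 1, ?_, ?_⟩
    · simp only [mem_symIoo, mem_Ioo]
      constructor <;> linarith
    · funext i
      obtain rfl : i = 0 := Fin.fin_one_eq_zero i
      simp only [halfAffine]
      ring

/-- `halfAffine` is a `ℚ`-polynomial map. [folklore] -/
theorem isSemialgebraicMapOn_halfAffine : IsSemialgebraicMapOn ℚ symIoo halfAffine := by
  convert isSemialgebraicMapOn_aeval isSemialgebraic_symIoo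
    (fun _ : Fin 1 => (C (1/2 : ℚ) * (1 + X 0) : MvPolynomial (Fin 1) ℚ)) using 2 with x
  funext i
  simp only [halfAffine, map_mul, map_add, map_one, MvPolynomial.aeval_C, MvPolynomial.aeval_X,
    eq_ratCast]
  push_cast
  ring

/-- **`[(-1,1), 1/√(1-x²)]`**, written as the pull-back of `betaHalfRep` along `halfAffine`
(integrand `β-kernel((1+x)/2) · |det| = 1/√(1−x²)`). [folklore] -/
def invSqrtRep : IntegralRep 1 where
  domain := symIoo
  integrand := fun x => betaKernel (1/2) (1/2) ((1 + x 0) / 2) * (1/2)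
  isSemialgebraic_domain := isSemialgebraic_symIoo
  isSemialgebraicFunOn_integrand := by
    refine isSemialgebraicFunOn_of_eqOn_inv_sqrt isSemialgebraic_symIoo (1 - X 0 ^ 2)
      (fun x hx => ?_) (fun x hx => ?_)
    · simp only [mem_symIoo, mem_Ioo] at hx
      simp only [map_sub, map_one, map_pow, MvPolynomial.aeval_X]
      nlinarith
    · simp only [map_sub, map_one, map_pow, MvPolynomial.aeval_X]
      exact betaKernel_half_affine (Ioo_subset_Icc_self hx)
  integrableOn := by
    have hmeas : MeasurableSet symIoo :=
      Literature.ModelTheory.ExponentialFields.IsSemialgebraic.measurableSet_holds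
        isSemialgebraic_symIoo
    have key := (integrableOn_image_iff_integrableOn_abs_det_fderiv_smul volume hmeas
      (f' := fun _ => halfAffineDeriv) (fun x _ => (hasFDerivAt_halfAffine x).hasFDerivWithinAt)
      injective_halfAffine.injOn (fun x : Fin 1 → ℝ => betaKernel (1/2) (1/2) (x 0))).1
      (by rw [image_halfAffine_symIoo]; exact betaHalfRep.integrableOn)
    refine key.congr_fun (fun x _ => ?_) hmeas
    simp only [abs_det_halfAffineDeriv, halfAffine, smul_eq_mul]
    ring

/-- The domain of `invSqrtRep`. [folklore] -/
@[simp] theorem invSqrtRep_domain : invSqrtRep.domain = symIoo := rfl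

/-- The integrand of `invSqrtRep` (literal). [folklore] -/
theorem invSqrtRep_integrand :
    invSqrtRep.integrand = fun x => betaKernel (1/2) (1/2) ((1 + x 0) / 2) * (1/2) := rfl

/-- The integrand of `invSqrtRep` is `1/√(1-x²)` on `(-1,1)`. [folklore] -/
theorem invSqrtRep_integrand_eq {x : Fin 1 → ℝ} (hx : x ∈ symIoo) :
    invSqrtRep.integrand x = (√(1 - x 0 ^ 2))⁻¹ :=
  betaKernel_half_affine (Ioo_subset_Icc_self hx)

/-- **Move 1**: `[(-1,1), 1/√(1-x²)] − [β(1/2,1/2)]` is ONE change-of-variables move. [folklore] -/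
theorem invSqrtRep_sub_betaHalfRep_mem : of invSqrtRep - of betaHalfRep ∈ changeOfVariablesRel :=
  ⟨1, invSqrtRep, betaHalfRep, halfAffine, fun _ => halfAffineDeriv, isSemialgebraicMapOn_halfAffine,
    fun x _ => (hasFDerivAt_halfAffine x).hasFDerivWithinAt, injective_halfAffine.injOn,
    image_halfAffine_symIoo.symm, fun x _ => by rw [abs_det_halfAffineDeriv]; rfl, rfl⟩

end Summit.KontsevichZagierPeriods.KontsevichZagierPeriods.BetaCancellationNegative
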